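import Literature.Analysis.ODE.HeunEulerContinuation
import Literature.Analysis.ODE.HeunEulerBranch
import Literature.Analysis.ODE.RiemannLiouvilleInjective
import HarnessLib

/-!
# The one-sided Euler / Riemann–Liouville transform for Heun's equation, off resonance
# (assembly: Takemura's Proposition 1.2 on the real segment with regularisation and injectivity)

Topic `Literature/Analysis/ODE` (namespace `Literature.Analysis.ODE`, sub-namespace `GeneralHeun`;
assembles `HeunEulerIntegrals.lean`, `HeunEulerContinuation.lean`, `HeunEulerBranch.lean` and
`RiemannLiouvilleInjective.lean`).

THE THEOREM (`eulerRL_nonres`). Let `v` be a classical solution of Umetsu's Heun equation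
`M_z(γ,δ,ε;α,β;q) v = 0` on `(1, z₂)` (`a_H = z₂ > 1`, Fuchs relation `γ+δ+ε = α+β+1`), let
`η ∈ {α, β}`, and let `v` be MODE DATA: `v(w) = (w−1)^ρ h(w)` near `1⁺` with `h` smooth on a
two-sided neighbourhood of `1`, `ρ = 1 − δ`, `Re ρ > −1`, and `v` smooth across `z₂`. Assume the
NON-RESONANCE condition `ρ + η − 1 ∉ ℤ_{≤ −1}`. Then there is mode data `u` for Takemura's image
parameters `(2−η, α+β−2η+1; γ−η+1, δ−η+1, ε−η+1; q′)` on `(1, z₂)` with branch exponent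
`ρ + η − 1` at `1`, smooth across `z₂`, such that `u ≡ 0 ⇒ v ≡ 0`. Concretely
`u = ∂_z^k Φ_{2−η−k}[ṽ]`, `k = ⌊Re(2−η)⌋`, where `Φ_κ[f](z) = ∫₁^z (z−w)^{−κ} f(w) dw` is the
one-sided Euler transform (a Riemann–Liouville integral) and `ṽ` is `v` continued smoothly past
`z₂`; i.e. `u` is the Riemann–Liouville DERIVATIVE `D^{1−η}_{1+} ṽ` up to a constant.

Ingredients: the ODE for `u` is `isSolutionOn_iteratedDeriv_eulerΦ` (analytic continuation in
the kernel exponent, `HeunEulerContinuation.lean`); the branch at `1` and the smoothness across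
`z₂` are `iteratedDeriv_eulerTransform_eq_cpow_mul_branchCofactor` and
`contDiffOn_iteratedDeriv_eulerTransform` (`HeunEulerBranch.lean`); injectivity is
`eq_zero_of_rlIntegral_eq_polynomial` (`RiemannLiouvilleInjective.lean`) after identifying
`Φ_κ = J^{1−κ}_{1+}` (`eulerΦ_eq_rlIntegral`) — this is where non-resonance enters; at resonance
the transform kills honest mode data (`(w−1)^{−α}` with `δ = 1+α`, `q = −αγ a_H`).

This is the hypothesis `EulerRLNonRes` of the Kerr–de Sitter venture's route W
(`Summits/Ventures/KdS/RouteWNonRes.lean`) with `HeunModeData` unfolded; the 4-line Summits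
wrapper lives there. No named facts are introduced.

## References
* K. Takemura, *Integral transformation of Heun's equation and some applications*, J. Math. Soc.
  Japan 69 (2017) 849–891, Prop. 1.2 (Kazakov–Slavyanov). Key `Takemura2017`.
* S. G. Samko, A. A. Kilbas, O. I. Marichev, *Fractional integrals and derivatives*, Gordon and
  Breach 1993, §2.3–§2.5. Key `SamkoKilbasMarichev1993`.
-/

noncomputable section

open Set Filter MeasureTheory intervalIntegral
open scoped Topology Interval


namespace Literature.Analysis.ODE

namespace GeneralHeun

open RiemannLiouville

/-- **Bridge to the Riemann–Liouville integral**: for `z > 1`,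
`Φ_κ[v](z) = J^{1−κ}_{1+} v (z) = ∫₁^z (z−w)^{−κ} v(w) dw`.
[cite: SamkoKilbasMarichev1993, §2.3 (2.17)–(2.18)] -/
theorem eulerΦ_eq_rlIntegral (κ : ℂ) (v : ℝ → ℂ) {z : ℝ} (hz : 1 < z) :
    eulerΦ κ v z = rlIntegral 1 (1 - κ) v z := by
  have hz1 : 0 < z - 1 := sub_pos.mpr hz
  rw [rlIntegral_eq_cpow_mul_integral 1 (1 - κ) v hz]
  unfold eulerΦ eulerΨ
  rw [eulerKernel_eq_cpow (κ - 1) hz1, neg_sub]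
  congr 1
  refine intervalIntegral.integral_congr_ae ?_
  have h1 : ∀ᵐ t : ℝ ∂volume, t ≠ 1 := by
    have : ({1}ᶜ : Set ℝ) ∈ ae volume := by
      rw [compl_mem_ae_iff]; exact measure_singleton 1
    filter_upwards [this] with t ht using ht
  filter_upwards [h1] with t ht1 ht
  rw [uIoc_of_le zero_le_one] at ht
  have ht' : 0 < 1 - t := sub_pos.mpr (lt_of_le_of_ne ht.2 ht1)
  unfold eulerΨIntegrand eulerPt
  rw [eulerKernel_eq_cpow κ ht', iteratedDeriv_zero, pow_zero, one_mul, sub_sub_cancel_left]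

/-- **The one-sided Euler / Riemann–Liouville transform for Heun's equation, off resonance**
(K. Takemura's Proposition 1.2 for the real segment `(1, z)`, with the classical Riemann–Liouville
regularisation and injectivity). Let `v` solve `M_z(γ,δ,ε;α,β;q) v = 0` classically on `(1, z₂)`
(`a_H = z₂ > 1`, Fuchs relation), let `η` be a root of the exponent pair (`(η−α)(η−β) = 0`), and
let `v` be mode data: `v = (w−1)^ρ h(w)` near `1⁺` with `h` smooth on a two-sided neighbourhood,
`ρ = 1 − δ`, `Re ρ > −1`, and `v` smooth across `z₂`; assume NON-RESONANCE `ρ + η − 1 ∉ ℤ_{≤−1}`.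
Then `u := ∂_z^k Φ_{2−η−k}[ṽ]` (`k = ⌊Re(2−η)⌋`, `ṽ` = `v` continued smoothly past `z₂`) is mode
data for Takemura's image parameters with branch exponent `ρ + η − 1` at `1`, smooth across `z₂`,
and `u ≡ 0 ⇒ v ≡ 0` on `(1, z₂)`. [cite: Takemura2017, Proposition 1.2; SamkoKilbasMarichev1993, §2.5 (Theorem 2.4)] -/
theorem eulerRL_nonres (z₂ : ℝ) (α β γ δ ε q η ρ : ℂ) (v : ℝ → ℂ) (hz₂ : 1 < z₂)
    (hF : γ + δ + ε = α + β + 1) (hroot : (η - α) * (η - β) = 0) (hρ : ρ = 1 - δ)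
    (hre : -1 < ρ.re) (hres : ∀ n : ℕ, ρ + η - 1 ≠ -((n : ℂ) + 1))
    (hsol : IsSolutionOn (z₂ : ℂ) α β γ δ ε q (Ioo 1 z₂) v)
    (h1 : ∃ e : ℝ, 0 < e ∧ ∃ h : ℝ → ℂ,
      ContDiffOn ℝ ((⊤ : ℕ∞) : WithTop ℕ∞) h (Ioo (1 - e) (1 + e)) ∧
      ∀ w ∈ Ioo 1 (1 + e), v w = ((w - 1 : ℝ) : ℂ) ^ ρ * h w)
    (h2 : ∃ e : ℝ, 0 < e ∧ ∃ g : ℝ → ℂ,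
      ContDiffOn ℝ ((⊤ : ℕ∞) : WithTop ℕ∞) g (Ioo (z₂ - e) (z₂ + e)) ∧
      ∀ w ∈ Ioo (z₂ - e) z₂, v w = g w) :
    ∃ u : ℝ → ℂ,
      (IsSolutionOn (z₂ : ℂ) (eulerSrcα η) (eulerSrcβ α β η) (eulerSrc γ η) (eulerSrc δ η)
          (eulerSrc ε η) (eulerSrcQ (z₂ : ℂ) γ δ ε q η) (Ioo 1 z₂) u ∧
        (∃ e : ℝ, 0 < e ∧ ∃ H : ℝ → ℂ,
          ContDiffOn ℝ ((⊤ : ℕ∞) : WithTop ℕ∞) H (Ioo (1 - e) (1 + e)) ∧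
          ∀ z ∈ Ioo 1 (1 + e), u z = ((z - 1 : ℝ) : ℂ) ^ (ρ + η - 1) * H z) ∧
        (∃ e : ℝ, 0 < e ∧ ∃ G : ℝ → ℂ,
          ContDiffOn ℝ ((⊤ : ℕ∞) : WithTop ℕ∞) G (Ioo (z₂ - e) (z₂ + e)) ∧
          ∀ z ∈ Ioo (z₂ - e) z₂, u z = G z)) ∧
      ((∀ z ∈ Ioo 1 z₂, u z = 0) → ∀ w ∈ Ioo 1 z₂, v w = 0) := by
  obtain ⟨e₁, he₁, h, hh, hvh⟩ := h1
  obtain ⟨e₂, he₂, g, hg, hvg⟩ := h2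
  -- exponents: `θ = 2 − η`, `k = ⌊Re θ⌋`, `κ = θ − k`
  set k : ℕ := ⌊(2 - η).re⌋₊ with hk
  have hθk : (2 - η).re < k + 1 := Nat.lt_floor_add_one (2 - η).re
  set κ : ℂ := 2 - η - k with hκdef
  have hκ1 : κ.re < 1 := by
    have h := hθk
    simp only [hκdef, Complex.sub_re, Complex.natCast_re] at h ⊢; linarith
  -- the glued source `ṽ`
  have hvs : ContDiffOn ℝ ((⊤ : ℕ∞) : WithTop ℕ∞) v (Ioo 1 z₂) :=
    contDiffOn_of_isSolutionOn isOpen_Ioo (fun x hx => lead_ne_zero_of_mem_Ioo hx) hsol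
  set vt : ℝ → ℂ := glue z₂ v g with hvt
  have hvt_eq : ∀ w ∈ Ioo 1 z₂, vt w = v w := fun w hw => glue_of_lt v g hw.2
  set b : ℝ := z₂ + e₂ with hb
  set B : ℝ := z₂ + e₂ / 2 with hB
  have hBb : B ≤ b := by rw [hB, hb]; linarith
  have hBb' : B < b := by rw [hB, hb]; linarith
  have hz₂B : z₂ < B := by rw [hB]; linarith
  have hz₂b : z₂ ≤ b := by rw [hb]; linarith
  have hz₂b' : z₂ < b := by rw [hb]; linarith
  have hvt_smooth : ContDiffOn ℝ ((⊤ : ℕ∞) : WithTop ℕ∞) vt (Ioo 1 b) :=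
    contDiffOn_glue he₂ hvs hg hvg
  -- chart at `1` for `ṽ`
  set e₁' : ℝ := min e₁ (z₂ - 1) with he₁'def
  have he₁' : 0 < e₁' := lt_min he₁ (sub_pos.mpr hz₂)
  have hh' : ContDiffOn ℝ ((⊤ : ℕ∞) : WithTop ℕ∞) h (Ioo (1 - e₁') (1 + e₁')) :=
    hh.mono (Ioo_subset_Ioo (by linarith [min_le_left e₁ (z₂ - 1)])
      (by linarith [min_le_left e₁ (z₂ - 1)]))
  have hchart : ∀ w ∈ Ioo 1 (1 + e₁'), vt w = ((w - 1 : ℝ) : ℂ) ^ ρ * h w := by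
    intro w hw
    have hwz : w < z₂ := by linarith [hw.2, min_le_right e₁ (z₂ - 1)]
    rw [hvt_eq w ⟨hw.1, hwz⟩]
    exact hvh w ⟨hw.1, lt_of_lt_of_le hw.2 (by linarith [min_le_left e₁ (z₂ - 1)])⟩
  have hbdB : EulerBound vt ρ.re B := eulerBound_of_branch he₁' hvt_smooth hh' hchart hBb'
  have hbd₂ : EulerBound vt ρ.re z₂ := eulerBound_of_branch he₁' hvt_smooth hh' hchart hz₂b'
  -- the transform and its `k`-th derivative
  set u : ℝ → ℂ := iteratedDeriv k (eulerΦ κ vt) with hu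
  have hΦdef : eulerΦ κ vt = fun y => eulerKernel (κ - 1) (y - 1) * eulerΨ κ vt 0 y := rfl
  have hu_smooth : ContDiffOn ℝ ((⊤ : ℕ∞) : WithTop ℕ∞) u (Ioo 1 B) := by
    rw [hu, hΦdef]
    exact contDiffOn_iteratedDeriv_eulerTransform hvt_smooth hbdB hBb hre hκ1 k
  have htower : ∀ i : ℕ, ∀ z ∈ Ioo 1 B,
      HasDerivAt (iteratedDeriv i (eulerΦ κ vt)) (iteratedDeriv (i + 1) (eulerΦ κ vt) z) z := by
    intro i z hz
    rw [hΦdef]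
    exact hasDerivAt_iteratedDeriv_eulerTransform hvt_smooth hbdB hBb hre hκ1 i hz
  -- `ṽ` solves the source equation on `(1, z₂)` in `iteratedDeriv` form
  have hsrc : ∀ w ∈ Ioo 1 z₂, lead (z₂ : ℂ) w * iteratedDeriv 2 vt w +
      mid (z₂ : ℂ) γ δ ε w * iteratedDeriv 1 vt w + low α β q w * vt w = 0 := by
    intro w hw
    obtain ⟨f₁, f₂, hs⟩ := hsol
    have hloc : vt =ᶠ[𝓝 w] v := by
      filter_upwards [Ioo_mem_nhds hw.1 hw.2] with y hy using hvt_eq y hy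
    have hd1 : ∀ y ∈ Ioo 1 z₂, deriv v y = f₁ y := fun y hy => (hs y hy).1.deriv
    have h1' : iteratedDeriv 1 vt w = f₁ w := by
      rw [hloc.iteratedDeriv_eq, iteratedDeriv_one, hd1 w hw]
    have h2' : iteratedDeriv 2 vt w = f₂ w := by
      rw [hloc.iteratedDeriv_eq, iteratedDeriv_succ, iteratedDeriv_one]
      have hloc' : deriv v =ᶠ[𝓝 w] f₁ := by
        filter_upwards [Ioo_mem_nhds hw.1 hw.2] with y hy using hd1 y hy
      rw [hloc'.deriv_eq, (hs w hw).2.1.deriv]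
    rw [h1', h2', hvt_eq w hw]
    exact (hs w hw).2.2
  refine ⟨u, ⟨?_, ?_, ?_⟩, ?_⟩
  · -- (a) the ODE on `(1, z₂)`: F2
    have h := isSolutionOn_iteratedDeriv_eulerΦ (aH := (z₂ : ℂ)) k hF hroot hθk hvt_smooth hbd₂
      hz₂b hre hρ hre ⟨e₁', he₁', h, hh', hchart⟩ hsrc
    rw [hu, hκdef]
    exact h
  · -- (b) the branch at `1`: F3
    refine ⟨e₁', he₁', branchCofactor κ ρ h k, contDiffOn_branchCofactor hh' hκ1 hre k,
      fun z hz => ?_⟩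
    have h := iteratedDeriv_eulerTransform_eq_cpow_mul_branchCofactor hh' hκ1 hre hchart k hz
    rw [hu, hΦdef, h]
    congr 2
    simp only [hκdef]
    ring
  · -- (c) the analytic branch at `z₂`: `u` itself is smooth across `z₂` (F3 on `(1, B)`)
    set e' : ℝ := min (e₂ / 2) ((z₂ - 1) / 2) with he'def
    have he' : 0 < e' := lt_min (by linarith) (by linarith)
    refine ⟨e', he', u, hu_smooth.mono fun z hz => ⟨?_, ?_⟩, fun z _ => rfl⟩
    · have : e' ≤ (z₂ - 1) / 2 := min_le_right _ _
      linarith [hz.1]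
    · have : e' ≤ e₂ / 2 := min_le_left _ _
      linarith [hz.2]
  · -- (d) injectivity: F4
    intro hu0 w hw
    obtain ⟨c, hc⟩ := eq_polynomial_of_hasDerivAt_tower (a := 1) (b := z₂) k
      (fun i => iteratedDeriv i (eulerΦ κ vt))
      (fun i _ z hz => htower i z ⟨hz.1, hz.2.trans hz₂B⟩) hu0
    have hpoly : ∀ z ∈ Ioo 1 z₂, rlIntegral 1 (1 - κ) vt z =
        ∑ j ∈ Finset.range k, c j * ((z - 1 : ℝ) : ℂ) ^ j := by
      intro z hz
      rw [← eulerΦ_eq_rlIntegral κ vt hz.1, ← hc z hz, iteratedDeriv_zero]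
    have hμ : 0 < (1 - κ).re := by simp; linarith
    have hres' : ∀ n : ℕ, ρ + (1 - κ) - k ≠ -((n : ℂ) + 1) := by
      intro n
      have : ρ + (1 - κ) - k = ρ + η - 1 := by simp only [hκdef]; ring
      rw [this]
      exact hres n
    have hzero := eq_zero_of_rlIntegral_eq_polynomial hμ hre k (hvt_smooth.continuousOn.mono
      (Ioo_subset_Ioo_right hz₂b)) ⟨e₁', he₁', h, hh', hchart⟩ hres' c hpoly
    rw [← hvt_eq w hw]
    exact hzero w hw

end GeneralHeun

end Literature.Analysis.ODE
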